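import Summits.BirchSwinnertonDyer.BirchSwinnertonDyer.Theorems.EdixhovenFibreFiveSevenStarredOptimalManinUnitFiveSevenReceptacleNoTorsion
import Summits.BirchSwinnertonDyer.Rank1Residual.Additive.CuspDivisionPolynomialSecondOrder
import Mathlib.FieldTheory.Finite.Basic
import HarnessLib

/-!
# The Kosters–Pannekoek receptacle hypothesis over an UNRAMIFIED `p`-adic field, `p ∈ {5, 7}`: a unit-abscissa
# `p`-torsion point on `y² = x³ + Ax + B` (`A, B ∈ pℤ_p`) forces `ū = 3A/5` resp. `4B/7 (mod p)` into `(k^×)^{p−1}`,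
# hence `E₀(K)[p] = 0` whenever `gcd([k : 𝔽_p], p − 1) = 1` and `ū ≠ 1` (short model)

Route `EdixhovenFibreFiveSeven`, crux K★ `StarredOptimalManinUnitFiveSeven` (stmt-BirchSwinnertonDyer-22226), line
`kato-lever`, seat `bsd-line-edix-p1` g5; `--supports` 22226 (helper; programme piece P2c of
`Cruxes/StarredOptimalManinUnitFiveSeven/Lines/kato-lever-F2-programme.md` §4/§7 — the receptacle hypothesis of F″ =
`Literature.NumberTheory.EllipticCurves.kato_neron_isIntegral_twistedSymbolSum_of_additive_five_le` on the
Kosters–Pannekoek cells `v₅(c₄) = 1` / `v₇(c₆) = 1`, i.e. for the route's cruxes TDS57 / KP57 rather than K★).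
TOOL theorems only (no definition, no named fact, no instance, no `sorry`); nothing is closed or booked; BSD is not
proved by any of this.

WHAT (F″'s docstring: "Kosters–Pannekoek Thm. 1 for `K/ℚ_p` unramified of degree `n` …: exceptional iff (iii) `p = 5`
and `N_{k/𝔽₅}(3a₄/5) = 1`, (iv) `p = 7` and `N_{k/𝔽₇}(4a₆/7) = 1`; for `E` over `ℚ_p`, `ū ∈ 𝔽_p`, so `N(ū) = ūⁿ`; if
`gcd(n, p − 1) = 1` then `ūⁿ = 1 ⟺ ū = 1`"). This file PROVES the half the receptacle needs, elementarily (Mazur's Step 1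
one order deeper, as in the tree's `ℚ_p`-only `Additive/LocalTorsionAnomalousResidue`), over any ultrametric `ℚ_p`-field:

* §1 finite-field algebra (`u^p = u`, `v^{p−1} = u`, `#k = p^n` ⟹ `u^n = 1`; `gcd(n, p−1) = 1 ⟹ u = 1`); §2 residues
  of `ℤ_p`-elements in `k = 𝒪_K/𝔪` are Frobenius-fixed.
* §3 ★ `exists_pow_four_eq_residue_of_five_torsion` / `exists_pow_six_eq_residue_of_seven_torsion`: on `y² = x³ + Ax + B`
  over `K`, `A = pA′`, `B = pB′`, a point `(x, y)` with `‖x‖ = 1` killed by `p` gives `v ∈ k^×` with `v⁴ = 3Ā′` (`p = 5`)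
  resp. `v⁶ = 4B̄′` (`p = 7`), `v = ȳ/x̄`: the second-order cusp jets `ψ₅ ≡ 5x¹² + 62Ax¹⁰ + 380Bx⁹`,
  `ψ₇ ≡ 7x²⁴ + 308Ax²² + 3944Bx²¹ (mod (A, B)² ⊆ p²)` (`CuspDivisionPolynomialSecondOrder`) give `x̄² = 3Ā′` resp.
  `x̄³ = 4B̄′`, and `ȳ² = x̄³` on the cuspidal reduction makes `x̄ = (ȳ/x̄)²`.
* §4 ★★ `noPTorsion_short_of_coprime` — `K/ℚ_p` finite UNRAMIFIED with residue field of order `p^n`, `gcd(n, p − 1) = 1`,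
  `p ∈ {5,7}`, `3A′ ≢ 1 (mod 5)` resp. `4B′ ≢ 1 (mod 7)` (`ū ≠ 1`): **`E₀(K)[p] = 0`** on the short model (cusp /
  kernel / unit trichotomy). The sibling `noPTorsion_short` is the case `Ā′ = 0` / `B̄′ = 0` (no residue-degree
  hypothesis). Transport to the minimal model of `W/ℚ` and the receptacle are the sibling `…ReceptacleKostersPannekoek`.

References: [KostersPannekoek2017] arXiv:1703.07888, Thm. 1 (iii)–(iv), Lemma 7–8, Cor. 2; [KimNakamura2020] Remark 1.8 (1);
[Mazur1977] Ch. III §5 Step 1; [SilvermanAEC2009] VII.2.1, VII.3.1, Exercise 3.7.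
-/

set_option autoImplicit false
-- the Theorems namespace of a single-conjunct summit repeats the summit name by design (D-0017)
set_option linter.dupNamespace false

noncomputable section
open scoped Classical NNReal
open WeierstrassCurve Polynomial Literature.NumberTheory.EllipticCurves Literature.NumberTheory.EllipticCurves.FormalGroupChart
open Literature.NumberTheory.EllipticCurves.CuspJets
open Summit.BirchSwinnertonDyer.Rank1Residual.Additive
open Summit.BirchSwinnertonDyer.Rank1Residual.Additive.BallEval
open Summit.BirchSwinnertonDyer.BirchSwinnertonDyer.Theorems.KPort
open Literature.NumberTheory.GaloisRepresentations.LubinTate (unitBall mem_unitBall_iff)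

namespace Summit.BirchSwinnertonDyer.BirchSwinnertonDyer.Theorems.StarredOptimalManinUnitFiveSevenReceptacle
/-! ## §1 Finite-field algebra: a Frobenius-fixed `(p−1)`-st power is `1` when `gcd([k:𝔽_p], p−1) = 1` -/

section FiniteField

variable {k : Type*} [Field k] {p : ℕ}

/-- `u^p = u` and `v^{p−1} = u` ⟹ `u^m = v^{p^m − 1}` for every `m` (`u^{m+1} = u^m·u^{p^m} = v^{p^m−1}·v^{(p−1)p^m}`).
[folklore] -/
theorem pow_eq_pow_sub_one_of_frobenius_fixed (hp : 1 ≤ p) {u v : k} (hu : u ^ p = u) (hv : v ^ (p - 1) = u)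
    (m : ℕ) : u ^ m = v ^ (p ^ m - 1) := by
  have hfix : ∀ j : ℕ, u ^ p ^ j = u := by
    intro j
    induction j with
    | zero => rw [pow_zero, pow_one]
    | succ j ih => rw [pow_succ, pow_mul, ih, hu]
  induction m with
  | zero => rw [pow_zero, pow_zero, Nat.sub_self, pow_zero]
  | succ m ih =>
    have h1 : 1 ≤ p ^ m := Nat.one_le_pow _ _ hp
    have h2 : p ^ m ≤ p ^ (m + 1) := Nat.pow_le_pow_right hp (Nat.le_succ m)
    have h3 : (p - 1) * p ^ m = p ^ (m + 1) - p ^ m := by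
      rw [Nat.sub_one_mul, ← pow_succ']
    have hexp : p ^ m - 1 + (p - 1) * p ^ m = p ^ (m + 1) - 1 := by rw [h3]; omega
    rw [pow_succ, ih, ← hfix m, ← hv, ← pow_mul, ← pow_add, hexp]

/-- In a finite field `k` with `#k = p^n`: `u^p = u`, `v ≠ 0`, `v^{p−1} = u` ⟹ `u^n = 1` (`u^n = v^{#k − 1} = 1`) —
the norm form `N_{k/𝔽_p}(u) = uⁿ = 1` of "`u` is a `(p−1)`-st power in `k^×`" for `u ∈ 𝔽_p`. [folklore] -/
theorem pow_eq_one_of_frobenius_fixed [Fintype k] (hp : 1 ≤ p) {n : ℕ} (hcard : Fintype.card k = p ^ n)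
    {u v : k} (hu : u ^ p = u) (hv0 : v ≠ 0) (hv : v ^ (p - 1) = u) : u ^ n = 1 := by
  rw [pow_eq_pow_sub_one_of_frobenius_fixed hp hu hv n, ← hcard]
  exact FiniteField.pow_card_sub_one_eq_one v hv0

/-- … and if moreover `gcd(n, p − 1) = 1` then `u = 1` (`u^{p−1} = 1` for `u ∈ 𝔽_p^×`). [folklore] -/
theorem eq_one_of_frobenius_fixed_of_coprime [Fintype k] (hp : 1 ≤ p) {n : ℕ} (hcard : Fintype.card k = p ^ n)
    (hn : n.Coprime (p - 1)) {u v : k} (hu : u ^ p = u) (hv0 : v ≠ 0) (hv : v ^ (p - 1) = u) : u = 1 := by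
  have hu0 : u ≠ 0 := by
    rintro rfl
    exact hv0 (pow_eq_zero_iff (by
      intro h0
      rw [h0, pow_zero] at hv
      exact one_ne_zero hv) |>.mp hv)
  have hup : u ^ (p - 1) = 1 := by
    have h : u ^ (p - 1) * u = 1 * u := by
      rw [← pow_succ, Nat.sub_add_cancel hp, hu, one_mul]
    exact mul_right_cancel₀ hu0 h
  exact (pow_eq_one_iff_of_coprime hn).mp ⟨pow_eq_one_of_frobenius_fixed hp hcard hu hv0 hv, hup⟩

/-- `(m : k)^p = m` in characteristic `p` (Fermat; `(x + 1)^p = x^p + 1`). [folklore] -/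
theorem natCast_pow_prime [Fact p.Prime] [CharP k p] (m : ℕ) : ((m : k)) ^ p = m := by
  induction m with
  | zero => rw [Nat.cast_zero, zero_pow (Fact.out : p.Prime).ne_zero]
  | succ m ih => rw [Nat.cast_succ, add_pow_char, ih, one_pow]

end FiniteField

/-! ## §2 Residues of `ℤ_p`-elements in `k = 𝒪_K/𝔪` are Frobenius-fixed -/

section Residue

variable {p : ℕ} [hp : Fact p.Prime] {K : Type*} [NontriviallyNormedField K] [NormedAlgebra ℚ_[p] K]
  [IsUltrametricDist K]

/-- The residue in `k = 𝒪_K/𝔪_K` of an element of `ℤ_p` is a natural number `< p` (`ℤ_p/p = 𝔽_p`). [folklore] -/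
theorem exists_residue_coeffHom_eq_natCast (z : ℤ_[p]) :
    ∃ m : ℕ, m < p ∧ IsLocalRing.residue (unitBall K) (coeffHom p K z) = m := by
  obtain ⟨m, hm, hzm⟩ := PadicInt.exists_mem_range z
  refine ⟨m, hm, ?_⟩
  rw [IsLocalRing.mem_maximalIdeal, PadicInt.mem_nonunits] at hzm
  have h : IsLocalRing.residue (unitBall K) (coeffHom p K (z - m)) = 0 :=
    residue_eq_zero_of_norm_lt_one (by rw [norm_coe_coeffHom]; exact hzm)
  rwa [map_sub, map_natCast, map_sub, map_natCast, sub_eq_zero] at h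

/-- **Residues of `ℤ_p`-elements are Frobenius-fixed**: `ū^p = ū` in `k` for `ū` the residue of `coeffHom z`,
`z ∈ ℤ_p`. [folklore] -/
theorem residue_coeffHom_pow_prime (z : ℤ_[p]) :
    (IsLocalRing.residue (unitBall K) (coeffHom p K z)) ^ p = IsLocalRing.residue (unitBall K) (coeffHom p K z) := by
  haveI := charP_residueField_unitBall p K
  obtain ⟨m, -, hm⟩ := exists_residue_coeffHom_eq_natCast (K := K) z
  rw [hm, natCast_pow_prime]

/-- `ū = 1` in `k` iff `p ∣ z − 1` in `ℤ_p`, for `ū` the residue of `z ∈ ℤ_p`. [folklore] -/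
theorem residue_coeffHom_eq_one_iff (z : ℤ_[p]) :
    IsLocalRing.residue (unitBall K) (coeffHom p K z) = 1 ↔ (p : ℤ_[p]) ∣ z - 1 := by
  have h := residue_eq_residue_iff_norm_sub_lt_one (coeffHom p K z) 1
  rw [map_one] at h
  rw [h, ← PadicInt.norm_lt_one_iff_dvd, ← norm_coe_coeffHom (p := p) (K := K), map_sub, map_one]
  rfl

end Residue

/-! ## §3 A unit-abscissa `p`-torsion point pins `ū` into `(k^×)^{p−1}` (`p = 5`, `p = 7`) -/

section UnitAbscissa

variable {p : ℕ} [hp : Fact p.Prime] {K : Type*} [NontriviallyNormedField K] [NormedAlgebra ℚ_[p] K]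
  [IsUltrametricDist K] {A B : ℤ_[p]}

/-- The curve equation in `𝒪_K` and the vanishing of `ψ_p` in `𝒪_K` for an integral point killed by `p` (odd `p`).
[cite: SilvermanAEC2009, Exercise 3.7(d),(f)] -/
theorem eval_preΨ'_eq_zero_unitBall [hE : ((shortCurve A B).map PadicInt.Coe.ringHom).IsElliptic] (hp2 : p ≠ 2)
    {x y : K} (h : (curveK p K (shortCurve A B)).toAffine.Nonsingular x y) (hx : ‖x‖ ≤ 1)
    (h0 : p • (Affine.Point.some x y h : (curveK p K (shortCurve A B)).toAffine.Point) = 0) :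
    ((shortCurve (coeffHom p K A) (coeffHom p K B)).preΨ' p).eval (⟨x, (mem_unitBall_iff K).mpr hx⟩ : unitBall K)
      = 0 := by
  haveI : (((shortCurve A B).map (coeffHom p K)).map (unitBall K).subtype).IsElliptic :=
    isElliptic_curveK p K (shortCurve A B)
  have hodd : ¬ Even p := fun he => hp2 ((Nat.Prime.even_iff hp.out).mp he)
  have h0' : (p : ℤ) • (Affine.Point.some x y h :
      (((shortCurve A B).map (coeffHom p K)).map (unitBall K).subtype).toAffine.Point) = 0 := by
    rw [natCast_zsmul]; exact h0
  have hψ := StarredOptimalManinUnitFiveSevenUnramifiedTorsion.eval_map_preΨ'_eq_zero_of_zsmul_eq_zero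
    (unitBall K).subtype ((shortCurve A B).map (coeffHom p K)) hodd h h0'
  rw [CuspTorsion.map_shortCurve, eval_map, show x = (unitBall K).subtype ⟨x, (mem_unitBall_iff K).mpr hx⟩ from rfl,
    eval₂_at_apply] at hψ
  have hinj : Function.Injective (unitBall K).subtype := Subtype.val_injective
  exact (map_eq_zero_iff _ hinj).mp hψ

/-- On the cuspidal reduction `ȳ² = x̄³`: the residues of an `E₀(K)`-point `(x, y)` with `‖x‖ ≤ 1` of
`y² = x³ + Ax + B`, `‖A‖, ‖B‖ < 1`, satisfy `ȳ² = x̄³`. [cite: SilvermanAEC2009, VII.2 Prop. 2.1] -/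
theorem residue_Y_sq_eq (hA : ‖A‖ < 1) (hB : ‖B‖ < 1) {x y : K} (h : (curveK p K (shortCurve A B)).toAffine.Nonsingular x y)
    (hx : ‖x‖ ≤ 1)
    (hP : (Affine.Point.some x y h : (curveK p K (shortCurve A B)).toAffine.Point) ∈
      ((shortCurve A B).map (coeffHom p K)).nonsingularReductionSubgroup
        (Valuation.integer.integers (NormedField.valuation (K := K)))) :
    (IsLocalRing.residue (unitBall K) ⟨y, (mem_unitBall_iff K).mpr (norm_Y_le_one_of_norm_X_le_one h hx)⟩) ^ 2 =
      (IsLocalRing.residue (unitBall K) ⟨x, (mem_unitBall_iff K).mpr hx⟩) ^ 3 := by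
  have hns := nonsingular_residue_of_mem h hx hP
  rw [map_residue_shortCurve_eq hA hB, Affine.nonsingular_iff', Affine.equation_iff'] at hns
  obtain ⟨heq, -⟩ := hns
  simp only [zero_mul, add_zero, sub_eq_zero] at heq
  exact heq

/-- ★ **`p = 5`: a unit-abscissa `5`-torsion point gives `v ∈ k^×` with `v⁴ = 3·Ā′`** (`A = 5A′`, `B = 5B′`;
`v = ȳ/x̄`): `ψ₅(x) = 0` and `ψ₅ ≡ 5x¹² + 62Ax¹⁰ + 380Bx⁹ (mod 25)` give `x̄² + 62Ā′ = 0`, i.e. `x̄² = 3Ā′` in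
characteristic `5`; `ȳ² = x̄³` gives `x̄ = (ȳ/x̄)²`. [cite: KostersPannekoek2017, Thm. 1 (iii) and Lemma 7] [cite: SilvermanAEC2009, Exercise 3.7] -/
theorem exists_pow_four_eq_residue_of_five_torsion [hE : ((shortCurve A B).map PadicInt.Coe.ringHom).IsElliptic]
    (hp5 : p = 5) {A' B' : ℤ_[p]} (hA : A = p * A') (hB : B = p * B')
    {x y : K} (h : (curveK p K (shortCurve A B)).toAffine.Nonsingular x y) (hx : ‖x‖ = 1)
    (hP : (Affine.Point.some x y h : (curveK p K (shortCurve A B)).toAffine.Point) ∈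
      ((shortCurve A B).map (coeffHom p K)).nonsingularReductionSubgroup
        (Valuation.integer.integers (NormedField.valuation (K := K))))
    (h0 : p • (Affine.Point.some x y h : (curveK p K (shortCurve A B)).toAffine.Point) = 0) :
    ∃ v : IsLocalRing.ResidueField (unitBall K), v ≠ 0 ∧
      v ^ (p - 1) = IsLocalRing.residue (unitBall K) (coeffHom p K (3 * A')) := by
  subst hp5
  haveI := charP_residueField_unitBall 5 K
  have hp2 : (5 : ℕ) ≠ 2 := by norm_num
  have hpn : ‖((5 : ℕ) : ℤ_[5])‖ < 1 := by
    rw [PadicInt.norm_p]; norm_num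
  have hA1 : ‖A‖ < 1 := by
    rw [hA, norm_mul]; exact mul_lt_one_of_nonneg_of_lt_one_left (norm_nonneg _) hpn (PadicInt.norm_le_one _)
  have hB1 : ‖B‖ < 1 := by
    rw [hB, norm_mul]; exact mul_lt_one_of_nonneg_of_lt_one_left (norm_nonneg _) hpn (PadicInt.norm_le_one _)
  -- names in `𝒪_K` and `k`
  set x₀ : unitBall K := ⟨x, (mem_unitBall_iff K).mpr hx.le⟩ with hx₀
  set y₀ : unitBall K := ⟨y, (mem_unitBall_iff K).mpr (norm_Y_le_one_of_norm_X_le_one h hx.le)⟩ with hy₀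
  have hA' : coeffHom 5 K A = (5 : unitBall K) * coeffHom 5 K A' := by rw [hA, map_mul, map_natCast]; rfl
  have hB' : coeffHom 5 K B = (5 : unitBall K) * coeffHom 5 K B' := by rw [hB, map_mul, map_natCast]; rfl
  -- `ψ₅(x₀) = 0` in `𝒪_K` and the second-order jet: `5·(x₀¹² + 62a x₀¹⁰ + 380 b x₀⁹) ∈ (25)`
  have hψ := eval_preΨ'_eq_zero_unitBall hp2 h hx.le h0
  rw [hA', hB'] at hψ
  have hjet := (CuspTorsion.eval_preΨ'_sub_cuspLinear_mem_span_sq (q := (5 : unitBall K))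
    (a := (5 : unitBall K) * coeffHom 5 K A') (b := (5 : unitBall K) * coeffHom 5 K B') (dvd_mul_right _ _)
    (dvd_mul_right _ _) x₀).1
  norm_num at hjet hψ
  rw [hψ, zero_sub, Ideal.neg_mem_iff, Ideal.mem_span_singleton] at hjet
  obtain ⟨t, ht⟩ := hjet
  -- cancel one factor `5` (𝒪_K is a domain of characteristic `0`)
  haveI : CharZero K := charZero_of_injective_algebraMap (algebraMap ℚ_[5] K).injective
  have h50 : (5 : unitBall K) ≠ 0 := by
    intro h0'
    have h5K : ((5 : unitBall K) : K) = ((0 : unitBall K) : K) := congrArg ((↑) : unitBall K → K) h0'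
    norm_num at h5K
  have hred : x₀ ^ 12 + 62 * coeffHom 5 K A' * x₀ ^ 10 + 380 * coeffHom 5 K B' * x₀ ^ 9 = 5 * t := by
    apply mul_left_cancel₀ h50
    linear_combination ht
  -- pass to `k`: `5 = 0`, `380 = 0`, `62 = 2`
  have h5 : ((5 : ℕ) : IsLocalRing.ResidueField (unitBall K)) = 0 :=
    natCast_prime_residueField_eq_zero (p := 5) (K := K)
  have h5' : (5 : IsLocalRing.ResidueField (unitBall K)) = 0 := by exact_mod_cast h5
  have hk := congrArg (IsLocalRing.residue (unitBall K)) hred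
  simp only [map_add, map_mul, map_pow, map_ofNat] at hk
  rw [show (380 : IsLocalRing.ResidueField (unitBall K)) = 5 * 76 by norm_num,
    show (62 : IsLocalRing.ResidueField (unitBall K)) = 5 * 12 + 2 by norm_num, h5'] at hk
  -- `x̄ ≠ 0`, `ȳ² = x̄³`
  set X := IsLocalRing.residue (unitBall K) x₀ with hX
  set Y := IsLocalRing.residue (unitBall K) y₀ with hY
  have hX0 : X ≠ 0 := fun h0' => by
    have := (residue_eq_zero_iff_norm_lt_one x₀).mp h0'
    rw [hx₀] at this; exact (lt_irrefl _) (hx ▸ this)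
  have hYX : Y ^ 2 = X ^ 3 := residue_Y_sq_eq hA1 hB1 h hx.le hP
  -- `x̄² = −2ā = 3ā`
  have hX2 : X ^ 2 = 3 * IsLocalRing.residue (unitBall K) (coeffHom 5 K A') := by
    have h' : X ^ 10 * (X ^ 2 + 2 * IsLocalRing.residue (unitBall K) (coeffHom 5 K A')) = 0 := by
      linear_combination hk
    rcases mul_eq_zero.mp h' with h'' | h''
    · exact absurd (pow_eq_zero_iff (by norm_num) |>.mp h'') hX0
    · have h3 : (3 : IsLocalRing.ResidueField (unitBall K)) = -2 + 5 := by norm_num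
      rw [h3, h5', add_zero]
      linear_combination h''
  refine ⟨Y / X, div_ne_zero (fun hY0 => hX0 ?_) hX0, ?_⟩
  · rw [hY0, zero_pow two_ne_zero] at hYX
    exact (pow_eq_zero_iff three_ne_zero).mp hYX.symm
  · rw [show (5 - 1 : ℕ) = 4 from rfl, map_mul, map_ofNat, map_mul, map_ofNat, ← hX2, div_pow,
      div_eq_iff (pow_ne_zero 4 hX0)]
    linear_combination (Y ^ 2 + X ^ 3) * hYX

/-- ★ **`p = 7`: a unit-abscissa `7`-torsion point gives `v ∈ k^×` with `v⁶ = 4·B̄′`** (`A = 7A′`, `B = 7B′`;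
`v = ȳ/x̄`): `ψ₇(x) = 0` and `ψ₇ ≡ 7x²⁴ + 308Ax²² + 3944Bx²¹ (mod 49)` give `x̄³ + 3B̄′ = 0`, i.e. `x̄³ = 4B̄′` in
characteristic `7`; `ȳ² = x̄³` gives `x̄ = (ȳ/x̄)²`. [cite: KostersPannekoek2017, Thm. 1 (iv) and Lemma 8] [cite: SilvermanAEC2009, Exercise 3.7] -/
theorem exists_pow_six_eq_residue_of_seven_torsion [hE : ((shortCurve A B).map PadicInt.Coe.ringHom).IsElliptic]
    (hp7 : p = 7) {A' B' : ℤ_[p]} (hA : A = p * A') (hB : B = p * B')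
    {x y : K} (h : (curveK p K (shortCurve A B)).toAffine.Nonsingular x y) (hx : ‖x‖ = 1)
    (hP : (Affine.Point.some x y h : (curveK p K (shortCurve A B)).toAffine.Point) ∈
      ((shortCurve A B).map (coeffHom p K)).nonsingularReductionSubgroup
        (Valuation.integer.integers (NormedField.valuation (K := K))))
    (h0 : p • (Affine.Point.some x y h : (curveK p K (shortCurve A B)).toAffine.Point) = 0) :
    ∃ v : IsLocalRing.ResidueField (unitBall K), v ≠ 0 ∧
      v ^ (p - 1) = IsLocalRing.residue (unitBall K) (coeffHom p K (4 * B')) := by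
  subst hp7
  haveI := charP_residueField_unitBall 7 K
  have hp2 : (7 : ℕ) ≠ 2 := by norm_num
  have hpn : ‖((7 : ℕ) : ℤ_[7])‖ < 1 := by
    rw [PadicInt.norm_p]; norm_num
  have hA1 : ‖A‖ < 1 := by
    rw [hA, norm_mul]; exact mul_lt_one_of_nonneg_of_lt_one_left (norm_nonneg _) hpn (PadicInt.norm_le_one _)
  have hB1 : ‖B‖ < 1 := by
    rw [hB, norm_mul]; exact mul_lt_one_of_nonneg_of_lt_one_left (norm_nonneg _) hpn (PadicInt.norm_le_one _)
  set x₀ : unitBall K := ⟨x, (mem_unitBall_iff K).mpr hx.le⟩ with hx₀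
  set y₀ : unitBall K := ⟨y, (mem_unitBall_iff K).mpr (norm_Y_le_one_of_norm_X_le_one h hx.le)⟩ with hy₀
  have hA' : coeffHom 7 K A = (7 : unitBall K) * coeffHom 7 K A' := by rw [hA, map_mul, map_natCast]; rfl
  have hB' : coeffHom 7 K B = (7 : unitBall K) * coeffHom 7 K B' := by rw [hB, map_mul, map_natCast]; rfl
  -- `ψ₇(x₀) = 0` in `𝒪_K` and the second-order jet: `7·(x₀²⁴ + 308a x₀²² + 3944 b x₀²¹) ∈ (49)`
  have hψ := eval_preΨ'_eq_zero_unitBall hp2 h hx.le h0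
  rw [hA', hB'] at hψ
  have hjet := (CuspTorsion.eval_preΨ'_sub_cuspLinear_mem_span_sq (q := (7 : unitBall K))
    (a := (7 : unitBall K) * coeffHom 7 K A') (b := (7 : unitBall K) * coeffHom 7 K B') (dvd_mul_right _ _)
    (dvd_mul_right _ _) x₀).2
  norm_num at hjet hψ
  rw [hψ, zero_sub, Ideal.neg_mem_iff, Ideal.mem_span_singleton] at hjet
  obtain ⟨t, ht⟩ := hjet
  haveI : CharZero K := charZero_of_injective_algebraMap (algebraMap ℚ_[7] K).injective
  have h70 : (7 : unitBall K) ≠ 0 := by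
    intro h0'
    have h7K : ((7 : unitBall K) : K) = ((0 : unitBall K) : K) := congrArg ((↑) : unitBall K → K) h0'
    norm_num at h7K
  have hred : x₀ ^ 24 + 308 * coeffHom 7 K A' * x₀ ^ 22 + 3944 * coeffHom 7 K B' * x₀ ^ 21 = 7 * t := by
    apply mul_left_cancel₀ h70
    linear_combination ht
  -- pass to `k`: `7 = 0`, `308 = 0`, `3944 = 3`
  have h7 : ((7 : ℕ) : IsLocalRing.ResidueField (unitBall K)) = 0 :=
    natCast_prime_residueField_eq_zero (p := 7) (K := K)
  have h7' : (7 : IsLocalRing.ResidueField (unitBall K)) = 0 := by exact_mod_cast h7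
  have hk := congrArg (IsLocalRing.residue (unitBall K)) hred
  simp only [map_add, map_mul, map_pow, map_ofNat] at hk
  rw [show (308 : IsLocalRing.ResidueField (unitBall K)) = 7 * 44 by norm_num,
    show (3944 : IsLocalRing.ResidueField (unitBall K)) = 7 * 563 + 3 by norm_num, h7'] at hk
  set X := IsLocalRing.residue (unitBall K) x₀ with hX
  set Y := IsLocalRing.residue (unitBall K) y₀ with hY
  have hX0 : X ≠ 0 := fun h0' => by
    have := (residue_eq_zero_iff_norm_lt_one x₀).mp h0'
    rw [hx₀] at this; exact (lt_irrefl _) (hx ▸ this)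
  have hYX : Y ^ 2 = X ^ 3 := residue_Y_sq_eq hA1 hB1 h hx.le hP
  -- `x̄³ = −3b̄ = 4b̄`
  have hX3 : X ^ 3 = 4 * IsLocalRing.residue (unitBall K) (coeffHom 7 K B') := by
    have h' : X ^ 21 * (X ^ 3 + 3 * IsLocalRing.residue (unitBall K) (coeffHom 7 K B')) = 0 := by
      linear_combination hk
    rcases mul_eq_zero.mp h' with h'' | h''
    · exact absurd (pow_eq_zero_iff (by norm_num) |>.mp h'') hX0
    · have h4 : (4 : IsLocalRing.ResidueField (unitBall K)) = -3 + 7 := by norm_num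
      rw [h4, h7', add_zero]
      linear_combination h''
  refine ⟨Y / X, div_ne_zero (fun hY0 => hX0 ?_) hX0, ?_⟩
  · rw [hY0, zero_pow two_ne_zero] at hYX
    exact (pow_eq_zero_iff three_ne_zero).mp hYX.symm
  · rw [show (7 - 1 : ℕ) = 6 from rfl, map_mul, map_ofNat, map_mul, map_ofNat, ← hX3, div_pow,
      div_eq_iff (pow_ne_zero 6 hX0)]
    linear_combination (Y ^ 4 + Y ^ 2 * X ^ 3 + X ^ 6) * hYX

end UnitAbscissa

/-! ## §4 `E₀(K)[p] = 0` on the short model: `gcd([k : 𝔽_p], p − 1) = 1` and `ū ≠ 1` -/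

section Assembly

variable {p : ℕ} [hp : Fact p.Prime] {K : Type*} [NontriviallyNormedField K] [NormedAlgebra ℚ_[p] K]
  [IsUltrametricDist K] {A B : ℤ_[p]}

/-- ★★ **The Kosters–Pannekoek receptacle hypothesis on the short model.** `K ⊇ ℚ_p` a finite UNRAMIFIED extension
(`‖z‖ < 1 ⇒ ‖z‖ ≤ ‖p‖`) with residue field of order `p^n`, `gcd(n, p − 1) = 1`, `p ∈ {5, 7}`, `y² = x³ + Ax + B`
with `A = pA′`, `B = pB′` and `3A′ ≢ 1 (mod 5)` (at `5`) / `4B′ ≢ 1 (mod 7)` (at `7`) — i.e. `ū ≠ 1`, i.e. (Cor. 2)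
off `a₄ ≡ 10 (25)` / `a₆ ≡ 14 (49)`: **`E₀(K)[p] = 0`**. Trichotomy on the abscissa: `‖x‖ < 1` is the cusp (not in
`E₀`), `‖x‖ > 1` is `E₁(K)[p] = 0` (tree), `‖x‖ = 1` gives `ū = v^{p−1}` (§3), `ū^n = 1` (§1), `ū = 1` (coprimality).
[cite: KostersPannekoek2017, Thm. 1 (iii)-(iv) and Cor. 2] [cite: KimNakamura2020, Remark 1.8 (1)] -/
theorem noPTorsion_short_of_coprime [hE : ((shortCurve A B).map PadicInt.Coe.ringHom).IsElliptic]
    [FiniteDimensional ℚ_[p] K] (hp57 : p = 5 ∨ p = 7) (hK : ∀ z : K, ‖z‖ < 1 → ‖z‖ ≤ ‖(p : K)‖) {n : ℕ}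
    (hcard : Nat.card (IsLocalRing.ResidueField (unitBall K)) = p ^ n) (hn : n.Coprime (p - 1))
    {A' B' : ℤ_[p]} (hA : A = p * A') (hB : B = p * B')
    (hne5 : p = 5 → ¬ (p : ℤ_[p]) ∣ 3 * A' - 1) (hne7 : p = 7 → ¬ (p : ℤ_[p]) ∣ 4 * B' - 1)
    {P : (curveK p K (shortCurve A B)).toAffine.Point}
    (hP : P ∈ ((shortCurve A B).map (coeffHom p K)).nonsingularReductionSubgroup
      (Valuation.integer.integers (NormedField.valuation (K := K))))
    (hpP : p • P = 0) : P = 0 := by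
  haveI := finite_residueField_unitBall p K
  letI : Fintype (IsLocalRing.ResidueField (unitBall K)) := Fintype.ofFinite _
  have hcard' : Fintype.card (IsLocalRing.ResidueField (unitBall K)) = p ^ n := by
    rw [← Nat.card_eq_fintype_card]; exact hcard
  have hp1' : 1 ≤ p := hp.out.one_lt.le
  have hpn : ‖(p : ℤ_[p])‖ < 1 := by
    rw [PadicInt.norm_p]; exact inv_lt_one_of_one_lt₀ (by exact_mod_cast hp.out.one_lt)
  have hA1 : ‖A‖ < 1 := by
    rw [hA, norm_mul]; exact mul_lt_one_of_nonneg_of_lt_one_left (norm_nonneg _) hpn (PadicInt.norm_le_one _)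
  have hB1 : ‖B‖ < 1 := by
    rw [hB, norm_mul]; exact mul_lt_one_of_nonneg_of_lt_one_left (norm_nonneg _) hpn (PadicInt.norm_le_one _)
  rcases P with _ | ⟨x, y, h⟩
  · rfl
  · exfalso
    have hx := one_le_norm_X_of_mem_nonsingularReductionSubgroup_short hA1 hB1 h hP
    rcases hx.eq_or_lt with hx1 | hx1
    · -- unit abscissa: `ū = v^{p-1}`, `ū^n = 1`, `ū = 1`
      rcases hp57 with hp5 | hp7
      · obtain ⟨v, hv0, hv⟩ := exists_pow_four_eq_residue_of_five_torsion hp5 hA hB h hx1.symm hP hpP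
        have h1 := eq_one_of_frobenius_fixed_of_coprime hp1' hcard' hn
          (residue_coeffHom_pow_prime (K := K) (3 * A')) hv0 hv
        exact hne5 hp5 ((residue_coeffHom_eq_one_iff _).mp h1)
      · obtain ⟨v, hv0, hv⟩ := exists_pow_six_eq_residue_of_seven_torsion hp7 hA hB h hx1.symm hP hpP
        have h1 := eq_one_of_frobenius_fixed_of_coprime hp1' hcard' hn
          (residue_coeffHom_pow_prime (K := K) (4 * B')) hv0 hv
        exact hne7 hp7 ((residue_coeffHom_eq_one_iff _).mp h1)
    · -- kernel of reduction: `E₁(K)[p] = 0`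
      haveI : ((shortCurve A B).map ((unitBall K).subtype.comp (coeffHom p K))).IsElliptic :=
        isElliptic_curveK p K (shortCurve A B)
      have hf : ∀ r : ℤ_[p], ‖((unitBall K).subtype.comp (coeffHom p K)) r‖ ≤ 1 := fun r => by
        rw [RingHom.comp_apply, Subring.subtype_apply, norm_coe_coeffHom]; exact PadicInt.norm_le_one r
      have hp3 : 3 ≤ p := by rcases hp57 with rfl | rfl <;> norm_num
      have hp0 : (p : K) ≠ 0 := norm_pos_iff.mp (norm_p_pos_lt (p := p) (K := K)).1
      have hp1 : ‖(p : K)‖ < 1 := (norm_p_pos_lt (p := p) (K := K)).2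
      exact UnramifiedKernelTorsion.not_prime_zsmul_eq_zero_of_one_lt_norm_unramified
        ((unitBall K).subtype.comp (coeffHom p K)) hf (shortCurve A B) hp3 hp0 hp1 hK h hx1
        (by rw [natCast_zsmul]; exact hpP)

end Assembly

end Summit.BirchSwinnertonDyer.BirchSwinnertonDyer.Theorems.StarredOptimalManinUnitFiveSevenReceptacle

end
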